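import Summits.CriticalPhenomena.PercolationContinuityZ3.Theses.PercNearOneGluing
import Literature.Probability.Percolation.PercolationProofs
import Literature.Probability.Percolation.ConditionalPositiveAssociationProofs
import Literature.Probability.Percolation.TwoClusterConditionalAssociationProofs
import Summits.CriticalPhenomena.PercolationContinuityZ3.Theorems.PercNearOneGluingAdditiveGluingGoodTwoRelays

/-! TTRL-lite variant V140 of stmt-CriticalPhenomena-4576 -/

namespace Summit.CriticalPhenomena.PercolationContinuityZ3.Theorems

open MeasureTheory Literature.Probability.LatticeModels Literature.Probability.Percolation
open scoped Classical BigOperators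

/-- TTRL-lite variant V140 (`bound_nat:n≤5`) of the registered stub `stub_goodStep` of
stmt-CriticalPhenomena-4576: on at most five vertices the inductive step of the good-quadruple
(penalised-selection) inequality holds.  If `A.card ≤ 3` this is the two-relay goodness theorem
`stub_goodStepTwoRelays_k41` (no induction hypothesis needed); if `A.card ≥ 4` then `A ∪ {o}`
exhausts `Fin n` (`n ≤ 5`), so the low neighbour `y ∉ A`, `y ≠ o` of the hypothesis cannot exist.
[this project] -/
theorem stub_goodStep_var140 : ∀ (n : ℕ) (w : Sym2 (Fin n) → unitInterval) (A : Finset (Fin n)) (o b : Fin n), n ≤ 5 → b ∈ A → o ∉ A → (∃ y : Fin n, y ∉ A ∧ y ≠ o ∧ (w s(o, y) : ℝ) ≠ 0) → (∀ w' : Sym2 (Fin n) → unitInterval, (Finset.univ.filter (fun v : Fin n => ∃ u : Fin n, 0 < (w' s(u, v) : ℝ))).card < (Finset.univ.filter (fun v : Fin n => ∃ u : Fin n, 0 < (w s(u, v) : ℝ))).card → ∀ (A' : Finset (Fin n)) (o' b' : Fin n), b' ∈ A' → o' ∉ A' → ∀ (t : ℝ) (sel : Finset (Fin n) → Fin n),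 (∀ W, sel W ∈ A') → (∀ a ∈ A', 1 - t ≤ (prodBernoulli w').real (openConn a b')) → (prodBernoulli w').real ((⋃ a ∈ A', openConn o' a) ∩ (openConn o' b')ᶜ) + ∑ W ∈ (Finset.univ : Finset (Finset (Fin n))).filter (fun W => o' ∈ W ∧ Disjoint W A'), (prodBernoulli w').real {ω : BondConfig (Fin n) | openCluster ω o' = (W : Set (Fin n))} * (prodBernoulli w').real (openConnIn ((W : Set (Fin n))ᶜ) (sel W) b')ᶜ ≤ t) → ∀ (t : ℝ) (sel : Finset (Fin n) → Fin n), (∀ W, sel W ∈ A) → (∀ a ∈ A, 1 - t ≤ (prodBernoulli w).real (openConn a b)) → (prodBernoulli w).real ((⋃ a ∈ A, openConn o a) ∩ (openConn o b)ᶜ) + ∑ W ∈ (Finset.univ : Finset (Finset (Fin n))).filter (fun W => o ∈ W ∧ Disjoint W A), (prodBernoulli w).real {ω : BondConfig (Fin n) | openCluster ω o = (W : Set (Fin n))} * (prodBernoulli w).real (openConnIn ((W : Set (Fin n))ᶜ) (sel W) b)ᶜ ≤ t := by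
  intro n w A o b hn hbA hoA hy _ih t sel hsel hrel
  by_cases hA : A.card ≤ 3
  · exact stub_goodStepTwoRelays_k41 n w A o b hbA hoA hA t sel hsel hrel
  · exfalso
    obtain ⟨y, hyA, hyo, -⟩ := hy
    have hoy : o ∉ insert y A := by
      rw [Finset.mem_insert]
      rintro (h | h)
      exacts [hyo h.symm, hoA h]
    have hle : (insert o (insert y A)).card ≤ Fintype.card (Fin n) := Finset.card_le_univ _
    rw [Fintype.card_fin, Finset.card_insert_of_notMem hoy, Finset.card_insert_of_notMem hyA] at hle
    omega

end Summit.CriticalPhenomena.PercolationContinuityZ3.Theorems
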